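import Literature.Probability.RandomPlanarGeometry.SAWCountMonotoneSixMulSubOne
import HarnessLib

/-!
# Monotonicity `cₙ ≤ cₙ₊₁` (O'Brien 1990) at `n = 6d - 1` for `d ≥ 3`, up to the POCKETED residual walks

Bookkeeping sequel of `SAWCountMonotoneSixMulSubOne.lean`.  There, at `n = 6d - 1`, the far both-trapped class
is empty by `le_of_bothTrapped_far` (`8d ≤ n + 5` fails as soon as `d ≥ 3`) and the near-polygons are disposed
of by the rotation rule, so that O'Brien's inequality holds for `d ≥ 4`, where moreover the pocketed class is
empty by `SAWCountMonotoneEscapeOdd.lean` (`6d - 1 ≤ 7d - 5`).  For `d = 3` (`n = 17` on `ℤ³`) the only class not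
excluded by a theorem is the POCKETED one (doomed but untrapped end, surrounded start); this file records the
corresponding inequality in every `d ≥ 3`:

* `count_le_count_succ_add_card_pocket` : **`c₆d₋₁ ≤ c₆d + #{ω ∈ R(d, 6d-1) : extCount ω (6d-1) ≠ 0}`**, `d ≥ 3`.

Exhaustive enumeration (lane «pcv-sawmu» a-p4 g26/g27, kit j307755 / j312058; not used in proofs): on `ℤ³`
the pocketed class at `n = 17` is empty (all `2736` residual walks are trapped at both ends), so `c₁₇ ≤ c₁₈`
on `ℤ³` holds by this theorem plus that census; a proof needs the pocket count of
`extCount_eq_zero_of_mem_escapeResidual_of_odd` sharpened by one unit at `d = 3`.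

[cite: MadrasSlade1993, §7.1 p. 231 (`c_{N+1} ≥ c_N`, O'Brien)] [cite: BDGS2012, §1.3 (`cₙ ≤ cₙ₊₁`, O'Brien 1990)]
-/

noncomputable section

open Literature.Probability.LatticeModels Literature.Probability.Percolation SimpleGraph

namespace Literature.Probability.RandomPlanarGeometry.SAW.Zd

variable {d : ℕ}

open Classical in
/-- **`c₆d₋₁ ≤ c₆d + #(pocketed residual walks)` for every `d ≥ 3`** (stated with `n + 1 = 6d`): at this
length the far both-trapped walks do not exist (`le_of_bothTrapped_far`) and the near-polygons are injected into
spare walks (`count_le_count_succ_add_card_far`), so only the residual walks with an untrapped (pocketed) end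
remain. [cite: BDGS2012, §1.3] -/
theorem count_le_count_succ_add_card_pocket (hd : 3 ≤ d) {n : ℕ} (hn : n + 1 = 6 * d) :
    count d n ≤ count d (n + 1) + ((escapeResidual d n).filter fun ω => extCount ω n ≠ 0).card := by
  have hodd : Odd n := ⟨3 * d - 1, by omega⟩
  refine (count_le_count_succ_add_card_far (by omega) hodd (by omega)).trans (Nat.add_le_add_left
    (Finset.card_le_card fun ω hω => ?_) _)
  obtain ⟨hR, h⟩ := Finset.mem_filter.1 hω
  refine Finset.mem_filter.2 ⟨hR, ?_⟩
  rcases h with h | hfar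
  · exact h
  · -- a far both-trapped walk would need `8d ≤ n + 5`
    intro ht
    obtain ⟨hs, -, hb⟩ := mem_escapeResidual.1 hR
    have := le_of_bothTrapped_far hs hodd ht hb (fun h' => hfar h'.symm)
    omega

open Classical in
/-- Hence O'Brien's inequality at `n = 6d - 1`, `d ≥ 3`, as soon as no residual walk there is pocketed (for
`d ≥ 4` this is `count_le_count_succ_six_mul_sub_one`; for `d = 3` the hypothesis is the lane's census).
[cite: BDGS2012, §1.3] -/
theorem count_le_count_succ_of_no_pocket (hd : 3 ≤ d) {n : ℕ} (hn : n + 1 = 6 * d)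
    (hnp : ∀ ω ∈ escapeResidual d n, extCount ω n = 0) : count d n ≤ count d (n + 1) := by
  have h := count_le_count_succ_add_card_pocket hd hn
  have hempty : ((escapeResidual d n).filter fun ω => extCount ω n ≠ 0) = ∅ :=
    Finset.eq_empty_of_forall_notMem fun ω hω => by
      obtain ⟨hR, hne⟩ := Finset.mem_filter.1 hω
      exact hne (hnp ω hR)
  rw [hempty, Finset.card_empty, add_zero] at h
  exact h

end Literature.Probability.RandomPlanarGeometry.SAW.Zd
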